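import Summits.CriticalPhenomena.SAWScalingLimit.Theorems.SAWTotalPositivityCriticalBubbleBoundJoinMacroDefs
import Summits.CriticalPhenomena.SAWScalingLimit.Theorems.SAWTotalPositivityCriticalBubbleBoundJoinRarity
import Summits.CriticalPhenomena.SAWScalingLimit.Theorems.SAWTotalPositivityCriticalBubbleBoundJoinTail
import Summits.CriticalPhenomena.SAWScalingLimit.Theorems.SAWTotalPositivityCriticalBubbleBoundJoinEntropy

/-!
# The two FLOORS of the macroscopic door (line `docking-census-joining`, crux
`SAWTotalPositivity.CriticalBubbleBound`, stmt-CriticalPhenomena-7117; lead prover c7)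

The macroscopic door `Join.criticalBubbleBound_of_ledger` closes the crux from an entropy exponent `κ`
(`JoinEntropyAt κ`) and a macroscopic rarity exponent `π` (`JoinMacroRarity π`) as soon as `κ + π > 2`.
This file lands the two proved instances (the floors of the door):

* `joinMacroRarity_zero : JoinMacroRarity 0` — every MACROSCOPIC global join plaquette is a global join
  plaquette (`Join.Umac_le_Urar`), and global join plaquettes are exponentially few (Hammond 2018,
  Prop. 4.5: `Join.gjoins_tail_bound` fed into `Join.Urar_le_of_tail`), whence
  `Umac i ≤ C (i+1) R'_{i+1} + C 2^{-4 i}`, i.e. exponent `π = 0` with `b = 1`; this is all that is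
  proved on the rarity side;
* `joinEntropyAt_three_halves : JoinEntropyAt (3 / 2)` — Hammond's entropy (Lemma 4.12; the tree theorem
  `Join.Dent_ge`: `c 2^{i/2} (R'_i)² ≤ Dent i` for large `i`), i.e. `κ = 3/2` since `3/2 - 1 = 1/2`.

With `(κ, π) = (3/2, 0)` one has `κ + π = 3/2 < 2`: the door stays shut at the floors; it needs a
macroscopic rarity gain `π > 1/2` (or more entropy).

Source: A. Hammond, *An upper bound on the number of self-avoiding polygons via joining*, Ann. Probab. 46
(2018) 175–206, Prop. 4.5 and Lemma 4.12.
-/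

noncomputable section

open Literature.Probability.LatticeModels
open Literature.Probability.RandomPlanarGeometry Literature.Probability.RandomPlanarGeometry.SAW
open scoped BigOperators ENNReal
open Summit.CriticalPhenomena.SAWScalingLimit.Theorems.CriticalBubbleBound.Negative
open Summit.CriticalPhenomena.SAWScalingLimit.Theorems.CriticalBubbleBound.Docking

namespace Summit.CriticalPhenomena.SAWScalingLimit.Theorems.CriticalBubbleBound.Join

/-- **Floor of the macroscopic rarity side: `JoinMacroRarity 0`.** Macroscopic global join plaquettes
are global join plaquettes (`Umac i ≤ Urar i`), and those are exponentially few (Hammond's Prop. 4.5,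
`gjoins_tail_bound` through `Urar_le_of_tail`): `Umac i ≤ C (i+1) R'_{i+1} + C 2^{-4 i}`, which is the
ledger's rarity shape with `(π, b) = (0, 1)` after `(i+1)^(1:ℝ) = i+1` and `2^(-0·i) = 1`.
[cite: Hammond2015SAPJoining, Proposition 4.5] -/
theorem joinMacroRarity_zero : JoinMacroRarity 0 := by
  obtain ⟨A, ρ, hA, hρ0, hρ1, htail⟩ := gjoins_tail_bound
  obtain ⟨C, hrar⟩ := Urar_le_of_tail A ρ hA hρ0 hρ1 htail
  refine ⟨C, 1, fun i => ?_⟩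
  rw [Real.rpow_one, neg_zero, zero_mul, Real.rpow_zero, mul_one]
  exact le_trans (Umac_le_Urar i) (hrar i)

/-- **Floor of the entropy side: `JoinEntropyAt (3 / 2)`** — Hammond's entropy of the shifted class
blocks (`Dent_ge`: `c 2^{i/2} (R'_i)² ≤ Dent i` for all large `i`), in the ledger's normalisation
`κ - 1 = 1/2`, i.e. `κ = 3/2`. [cite: Hammond2015SAPJoining, Lemma 4.12] -/
theorem joinEntropyAt_three_halves : JoinEntropyAt (3 / 2) := by
  obtain ⟨c, hc, i₀, hent⟩ := Dent_ge
  refine ⟨c, hc, i₀, fun i hi => ?_⟩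
  have h12 : ((3 / 2 : ℝ) - 1) = 1 / 2 := by norm_num
  rw [h12]
  exact hent i hi

end Summit.CriticalPhenomena.SAWScalingLimit.Theorems.CriticalBubbleBound.Join

end
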